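import Summits.QuantumFields.YangMills.Theorems.UnitScaleTiltProp7CovariantModelFibreGrowth
import Summits.QuantumFields.YangMills.Theorems.UnitScaleTiltProp8ActionFirstVariation
import HarnessLib

/-!
# Route `UnitScaleTilt`, crux K1 child «MinimiserStabilityRegPr» (stmt-QuantumFields-19200), registered stub `stub_prop7From14` (leaf V3 «Prop 7 from a
# background (14)») — THE `ℓ²` GROWTH ASSEMBLY: **THE FIRST-ORDER TERM AT A CRITICAL CONFIGURATION IS ABSORBED BY THE COERCIVE TERM** (abstract spine), and
# its instance on the model averaging fibre: **STRICT QUADRATIC GROWTH `(1/1200)·L^{−2(K−n)}·Σ‖Y‖² ≤ A(U) − A(U₀)`** at a model-critical small-field `U₀`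

Cell `ym3-torus` ∕ fleet seat `ym-ust-19200-p1` (gen 5).  WHERE THIS SITS.  The `ℓ²` route to the uniqueness clause of [Balaban1985Variational] Prop. 7 at the
d = 3 carrier (`Prop7UniquenessReduction.atMostOneCriticalOrbit_of_chart_of_quadraticGrowth`, p504929) needs, at a critical `U₀`, the growth
`κ·Σ‖Y‖² ≤ A(U) − A(U₀)` along the secants `U = (1+Y)U₀` of the averaging fibre.  The lineage has: growth MODULO the exact first-order term `Lin_{U₀}`
(`Prop7CovLineAvgTaylor.wilsonAction4_sub_background_ge_of_modelFibre_T3`, p521440, model fibre), the second-order smallness of the linearised constraint on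
the fibre (`norm_covLineSum_le_of_modelFibre`, p520587), right inverses of the linearised averaging with `ℓ¹` bounds (p503703, p517074; `Prop7AvgLinearisation.
exists_rightInverse_iterLin` of the p2 lineage for the true (0.4) operator at the flat background), and the Euler–Lagrange equation (p2 lineage `Prop8Criticality`:
`Lin_{U₀}` vanishes on the tangent space of the fibre).  THIS FILE is the spine that puts them together, once abstractly and once at the model fibre:

* §1 **`growth_of_growthModLin`** (finite index types, seminormed values; [folklore] linear algebra): if `c·Σ‖Y‖² ≤ ΔA − Λ(Y)` (growth modulo the linear
  functional `Λ`), `Λ` vanishes on `ker T` (criticality for the constraint linearised by `T`), `T` has a right inverse `H` with `Σ_b‖HW(b)‖ ≤ B·Σ_c‖W(c)‖`,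
  `|Λ(Z)| ≤ j₀·Σ_b‖Z(b)‖` (the current is sup-bounded), and `Σ_c‖(TY)(c)‖ ≤ κ·Σ_b‖Y(b)‖²` (on the fibre the linearised constraint is second order), then
  `(c − j₀Bκ)·Σ‖Y‖² ≤ ΔA` — because `Λ(Y) = Λ(H(TY))` (`Y − H(TY) ∈ ker T`).  `growth_half_of_growthModLin`: `j₀Bκ ≤ c/2 ⇒ (c/2)Σ‖Y‖² ≤ ΔA`.
* §2 **`wilsonAction4_sub_background_ge_of_modelCritical_T3`** — THE MODEL INSTANCE (d = 3, `SU(2)`, straight contours with comb transports = the model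
  constraint of p520587/p521440, covariant Landau gauge): at a background `U₀` with `dist1(U₀(∂p)) ≤ εL^{−2(K−n)}` (`4·10⁵ε ≤ 1`) which is CRITICAL FOR THE MODEL
  CONSTRAINT in multiplier form — `Lin_{U₀}` vanishes on the kernel of the linearised model average `T_{U₀}` (block sums of comb∘line-transported `Y`), `T_{U₀}`
  has a right inverse with `ℓ¹` bound `B·L^{−(K−n)}`, and the current bound `|Lin_{U₀}(Z)| ≤ j·L^{−3(K−n)}·Σ‖Z‖` (print's divergence clause of (6)/(14)) — with
  `4800·j·B ≤ 1`: every model-fibre secant `U = (1+Y)U₀` with `2000L^{K−n}max‖Y‖ ≤ 1`, `D^*_{U₀}Y = 0` obeys `(1/1200)L^{−2(K−n)}Σ_b‖Y(b)‖² ≤ A(U) − A(U₀)`.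
  The constants are ABSOLUTE (no `k`, `L`, volume): the scaling ledger of CARD-19200-V3-g4 kernel-checked — `Lin ≲ (jL^{−3k})·(BL^{−k})·(2L^{2k})Σ‖Y‖²`
  against the coercive `(1/600)L^{−2k}Σ‖Y‖²`.

HONEST SCOPE.  §2 is the MODEL constraint (straight contours), not the (0.4) average of record, and takes model-criticality, the right inverse and the current
bound as hypotheses (the flat right inverse is p503703/`B5Eq117CompositionV1.faceFieldIter`; the small-field one and the current bound
`|Lin_{U₀}(Z)| ≤ C·ε₀L^{−3(K−n)}Σ‖Z‖` from clause 2 of (14) are separate files of this seat).  Full covariant Landau gauge (print's slice (21) is `R(U₀)D^*A = 0`).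
Sorry-free, no definition; nothing of Bałaban's is asserted.

References: T. Bałaban, CMP 102 (1985) 277–309 [Balaban1985Variational] ((6) p.278, (19)–(28) pp.281–282, (141)–(143) p.299, (152) p.300).
-/

noncomputable section

open scoped BigOperators Matrix.Norms.L2Operator Matrix

/-! ## §1 The abstract spine -/

namespace Summit.QuantumFields.YangMills.Theorems.Prop7GrowthAssembly

open Finset

section Abstract

variable {β γ : Type*} [Fintype β] [Fintype γ] {E E' : Type*} [SeminormedAddCommGroup E] [SeminormedAddCommGroup E']

omit [Fintype β] [Fintype γ] in
/-- **THE FIRST-ORDER TERM AT A CRITICAL POINT IS CARRIED BY THE CONSTRAINT DEFECT**: if `Λ` respects differences and vanishes on `ker T`, `T` respects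
differences and `T(HW) = W`, then `Λ(Y) = Λ(H(TY))`. [folklore] -/
theorem lin_eq_lin_rightInverse (Λ : (β → E) → ℝ) (T : (β → E) → (γ → E')) (H : (γ → E') → (β → E))
    (hΛsub : ∀ Z Z', Λ (Z - Z') = Λ Z - Λ Z') (hTsub : ∀ Z Z', T (Z - Z') = T Z - T Z') (hTH : ∀ W, T (H W) = W)
    (hEL : ∀ Z, T Z = 0 → Λ Z = 0) (Y : β → E) : Λ Y = Λ (H (T Y)) := by
  have hker : T (Y - H (T Y)) = 0 := by rw [hTsub, hTH, sub_self]
  have h0 := hEL _ hker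
  rw [hΛsub] at h0
  linarith

/-- **`|Λ(Y)| ≤ j₀·B·Σ_c‖(TY)(c)‖`**: with `|Λ(Z)| ≤ j₀Σ‖Z‖` and the `ℓ¹ → ℓ¹` bound `B` of the right inverse. [folklore] -/
theorem abs_lin_le_of_annihilates_ker (Λ : (β → E) → ℝ) (T : (β → E) → (γ → E')) (H : (γ → E') → (β → E))
    (hΛsub : ∀ Z Z', Λ (Z - Z') = Λ Z - Λ Z') (hTsub : ∀ Z Z', T (Z - Z') = T Z - T Z') (hTH : ∀ W, T (H W) = W)
    {B : ℝ} (hH : ∀ W, ∑ b, ‖H W b‖ ≤ B * ∑ c, ‖W c‖) (hEL : ∀ Z, T Z = 0 → Λ Z = 0)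
    {j₀ : ℝ} (hj₀ : 0 ≤ j₀) (hJ : ∀ Z, |Λ Z| ≤ j₀ * ∑ b, ‖Z b‖) (Y : β → E) :
    |Λ Y| ≤ j₀ * B * ∑ c, ‖T Y c‖ := by
  rw [lin_eq_lin_rightInverse Λ T H hΛsub hTsub hTH hEL Y, mul_assoc]
  exact (hJ _).trans (mul_le_mul_of_nonneg_left (hH _) hj₀)

/-- **GROWTH FROM GROWTH MODULO THE LINEAR TERM** (the `ℓ²` assembly spine): `c·Σ‖Y‖² ≤ ΔA − Λ(Y)`, `Λ` vanishes on `ker T`, `T(HW) = W` with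
`Σ‖HW‖ ≤ BΣ‖W‖`, `|Λ(Z)| ≤ j₀Σ‖Z‖`, `Σ_c‖(TY)(c)‖ ≤ κΣ_b‖Y(b)‖²` ⟹ `(c − j₀Bκ)·Σ‖Y‖² ≤ ΔA`. [folklore] -/
theorem growth_of_growthModLin (Λ : (β → E) → ℝ) (T : (β → E) → (γ → E')) (H : (γ → E') → (β → E))
    (hΛsub : ∀ Z Z', Λ (Z - Z') = Λ Z - Λ Z') (hTsub : ∀ Z Z', T (Z - Z') = T Z - T Z') (hTH : ∀ W, T (H W) = W)
    {B : ℝ} (hB : 0 ≤ B) (hH : ∀ W, ∑ b, ‖H W b‖ ≤ B * ∑ c, ‖W c‖) (hEL : ∀ Z, T Z = 0 → Λ Z = 0)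
    {j₀ : ℝ} (hj₀ : 0 ≤ j₀) (hJ : ∀ Z, |Λ Z| ≤ j₀ * ∑ b, ‖Z b‖)
    (Y : β → E) {κ : ℝ} (hF : ∑ c, ‖T Y c‖ ≤ κ * ∑ b, ‖Y b‖ ^ 2) {c ΔA : ℝ} (hG : c * ∑ b, ‖Y b‖ ^ 2 ≤ ΔA - Λ Y) :
    (c - j₀ * B * κ) * ∑ b, ‖Y b‖ ^ 2 ≤ ΔA := by
  have h1 := abs_lin_le_of_annihilates_ker Λ T H hΛsub hTsub hTH hH hEL hj₀ hJ Y
  have h2 : |Λ Y| ≤ j₀ * B * (κ * ∑ b, ‖Y b‖ ^ 2) := h1.trans (mul_le_mul_of_nonneg_left hF (mul_nonneg hj₀ hB))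
  have h3 := neg_abs_le (Λ Y)
  nlinarith [h2, h3, hG]

/-- **HALF THE COERCIVE CONSTANT SURVIVES** when `j₀Bκ ≤ c/2`: `(c/2)·Σ‖Y‖² ≤ ΔA`. [folklore] -/
theorem growth_half_of_growthModLin (Λ : (β → E) → ℝ) (T : (β → E) → (γ → E')) (H : (γ → E') → (β → E))
    (hΛsub : ∀ Z Z', Λ (Z - Z') = Λ Z - Λ Z') (hTsub : ∀ Z Z', T (Z - Z') = T Z - T Z') (hTH : ∀ W, T (H W) = W)
    {B : ℝ} (hB : 0 ≤ B) (hH : ∀ W, ∑ b, ‖H W b‖ ≤ B * ∑ c, ‖W c‖) (hEL : ∀ Z, T Z = 0 → Λ Z = 0)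
    {j₀ : ℝ} (hj₀ : 0 ≤ j₀) (hJ : ∀ Z, |Λ Z| ≤ j₀ * ∑ b, ‖Z b‖)
    (Y : β → E) {κ : ℝ} (hF : ∑ c, ‖T Y c‖ ≤ κ * ∑ b, ‖Y b‖ ^ 2) {c ΔA : ℝ} (hG : c * ∑ b, ‖Y b‖ ^ 2 ≤ ΔA - Λ Y)
    (hsmall : j₀ * B * κ ≤ c / 2) : (c / 2) * ∑ b, ‖Y b‖ ^ 2 ≤ ΔA := by
  have h := growth_of_growthModLin Λ T H hΛsub hTsub hTH hB hH hEL hj₀ hJ Y hF hG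
  have hS : 0 ≤ ∑ b, ‖Y b‖ ^ 2 := Finset.sum_nonneg fun _ _ => sq_nonneg _
  nlinarith [h, hS, hsmall]

end Abstract

/-- **STRICT GROWTH**: under the half-constant conclusion with `c > 0`, `ΔA > 0` unless `Y = 0` (values in a normed group). [folklore] -/
theorem pos_of_growth_half {β : Type*} [Fintype β] {E : Type*} [NormedAddCommGroup E] (Y : β → E) {c ΔA : ℝ} (hc : 0 < c)
    (h : (c / 2) * ∑ b, ‖Y b‖ ^ 2 ≤ ΔA) (hY : Y ≠ 0) : 0 < ΔA := by
  obtain ⟨b, hb⟩ : ∃ b, Y b ≠ 0 := by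
    by_contra hcon
    push Not at hcon
    exact hY (funext hcon)
  have hpos : 0 < ∑ b', ‖Y b'‖ ^ 2 :=
    lt_of_lt_of_le (by positivity : 0 < ‖Y b‖ ^ 2) (Finset.single_le_sum (fun b' _ => sq_nonneg ‖Y b'‖) (Finset.mem_univ b))
  nlinarith

/-! ## §2 The model instance at the d = 3 carrier -/

section Model

open Literature.MathematicalPhysics.QuantumFieldTheory.Balaban1983to89
open B1RG242Torus LatticeFieldCalculus
open B7Prop1Explicit (U1 treeWord)
open B7Eq78Linearization (conjR conjR_sub)
open B9Eq39Adjoint (divB)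
open B10Eq27TorusAxialLog (holT unitsField toUField)
open B9TorusCalculus (torusT)
open Summit.QuantumFields.YangMills.Theorems.Prop7CovariantCoercivity (holT_mem hyp_of_specialUnitary)
open Summit.QuantumFields.YangMills.Theorems.Prop7CovLineAvgTaylor (norm_covLineSum_le_of_modelFibre sum_sum_normSq_line_le sum_pair_normSq_eq
  wilsonAction4_sub_background_ge_of_modelFibre_T3)
open Summit.QuantumFields.YangMills.Theorems.Prop8Criticality (linPlaq_sub_smul)

set_option maxHeartbeats 400000 in
/-- **STRICT QUADRATIC GROWTH ON THE MODEL FIBRE AT A MODEL-CRITICAL SMALL-FIELD BACKGROUND, d = 3 CARRIER.**  `SU(2)` configurations `U`, `U₀` of run `K`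
(comparison height `n`), `dist1(U₀(∂p)) ≤ εL^{−2(K−n)}` with `4·10⁵ε ≤ 1`; `Y = UU₀^* − 1` with `‖Y‖ ≤ δ`, `2000L^{K−n}δ ≤ 1`; covariant Landau gauge
`D^*_{U₀}Y = 0`; `U` on the model averaging fibre of `U₀` (vanishing block sums of the comb-transported straight-contour ratios).  Let `Λ = Lin_{U₀}` be the exact
first-order term of the action (p482559/p521440, verbatim) and `T = T_{U₀}` the linearised model average (block sums of the comb∘line-transported field).  IF
`U₀` is critical for the model constraint — `Λ` vanishes on `ker T` — and `T` has a right inverse `H` with `Σ_b‖HW(b)‖ ≤ B·L^{−(K−n)}·Σ_c‖W(c)‖`, and the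
current obeys `|Λ(Z)| ≤ j·L^{−3(K−n)}·Σ_b‖Z(b)‖`, with `4800·j·B ≤ 1`, THEN `(1/1200)·L^{−2(K−n)}·Σ_b‖Y(b)‖² ≤ A(U) − A(U₀)`.
[cite: Balaban1985Variational, (141)-(143) p.299, (152) p.300] -/
theorem wilsonAction4_sub_background_ge_of_modelCritical_T3 (F : T3ContinuumYM3Torus.T3Family) (n K : ℕ)
    (U U₀ : GaugeField (F.P K) 0 (Matrix.specialUnitaryGroup (Fin 2) ℂ)) (Y : PBond (F.P K) 0 → Matrix (Fin 2) (Fin 2) ℂ)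
    (hYU : ∀ b : PBond (F.P K) 0, Y b = (U b : Matrix (Fin 2) (Fin 2) ℂ) * star (U₀ b : Matrix (Fin 2) (Fin 2) ℂ) - 1)
    {ε δ : ℝ} (hε : 0 ≤ ε) (hε1 : 400000 * ε ≤ 1)
    (hU₀ : ∀ p : Plaq (F.P K) 0, dist1 (GaugeField.plaqHol U₀ p) ≤ ε * (((F.L : ℝ) ^ (K - n)) ^ 2)⁻¹)
    (hδ : ∀ b : PBond (F.P K) 0, ‖Y b‖ ≤ δ) (hδn : 2000 * (F.L : ℝ) ^ (K - n) * δ ≤ 1)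
    (hdiv : ∀ x : Site (F.P K) 0, divB (torusT (F.P K) 0) (fun κ z => unitsField (toUField U₀) ⟨z, κ⟩) (fun κ z => Y ⟨z, κ⟩) x = 0)
    (hfib : ∀ c : PBond (F.P K) (K - n), ∑ r : Fin (F.P K).d → Fin ((F.P K).L ^ (K - n)),
      conjR (holT (unitsField (toUField U₀)) (Site.fibreSite 0 (K - n) c.src fun _ => ⟨0, pow_pos (F.P K).L_pos (K - n)⟩)
              (treeWord fun ν => ((r ν : ℕ) : ℤ)))
        (((holT (unitsField (toUField U)) (Site.fibreSite 0 (K - n) c.src r) (List.replicate ((F.P K).L ^ (K - n)) (c.dir, true))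
              : (Matrix (Fin 2) (Fin 2) ℂ)ˣ) : Matrix (Fin 2) (Fin 2) ℂ)
          * (((holT (unitsField (toUField U₀)) (Site.fibreSite 0 (K - n) c.src r) (List.replicate ((F.P K).L ^ (K - n)) (c.dir, true)))⁻¹
              : (Matrix (Fin 2) (Fin 2) ℂ)ˣ) : Matrix (Fin 2) (Fin 2) ℂ) - 1) = 0)
    -- the exact first-order term `Lin_{U₀}` (verbatim p482559/p521440), as a functional
    (Λ : (PBond (F.P K) 0 → Matrix (Fin 2) (Fin 2) ℂ) → ℝ)
    (hΛ : ∀ Z, Λ Z = ∑ p : Plaq (F.P K) 0, (1 / 2) * ((((((GaugeField.plaqHol U₀ p : Matrix.specialUnitaryGroup (Fin 2) ℂ) : Matrix (Fin 2) (Fin 2) ℂ)) - 1)ᴴ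
          * ((Z ⟨p.src, p.μ⟩
              + (U₀ ⟨p.src, p.μ⟩ : Matrix (Fin 2) (Fin 2) ℂ) * Z ⟨p.src.shift p.μ, p.ν⟩ * star (U₀ ⟨p.src, p.μ⟩ : Matrix (Fin 2) (Fin 2) ℂ)
              - ((U₀ ⟨p.src, p.μ⟩ * U₀ ⟨p.src.shift p.μ, p.ν⟩ * (U₀ ⟨p.src.shift p.ν, p.μ⟩)⁻¹ : Matrix.specialUnitaryGroup (Fin 2) ℂ) : Matrix (Fin 2) (Fin 2) ℂ)
                  * Z ⟨p.src.shift p.ν, p.μ⟩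
                  * star ((U₀ ⟨p.src, p.μ⟩ * U₀ ⟨p.src.shift p.μ, p.ν⟩ * (U₀ ⟨p.src.shift p.ν, p.μ⟩)⁻¹ : Matrix.specialUnitaryGroup (Fin 2) ℂ) : Matrix (Fin 2) (Fin 2) ℂ)
              - ((GaugeField.plaqHol U₀ p : Matrix.specialUnitaryGroup (Fin 2) ℂ) : Matrix (Fin 2) (Fin 2) ℂ) * Z ⟨p.src, p.ν⟩
                  * star ((GaugeField.plaqHol U₀ p : Matrix.specialUnitaryGroup (Fin 2) ℂ) : Matrix (Fin 2) (Fin 2) ℂ))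
            * ((GaugeField.plaqHol U₀ p : Matrix.specialUnitaryGroup (Fin 2) ℂ) : Matrix (Fin 2) (Fin 2) ℂ))).trace).re)
    -- the linearised model average `T_{U₀}` (block sums of the comb∘line-transported field), as an operator
    (T : (PBond (F.P K) 0 → Matrix (Fin 2) (Fin 2) ℂ) → PBond (F.P K) (K - n) → Matrix (Fin 2) (Fin 2) ℂ)
    (hT : ∀ Z c, T Z c = ∑ r : Fin (F.P K).d → Fin ((F.P K).L ^ (K - n)), ∑ t : Fin ((F.P K).L ^ (K - n)),
        conjR (holT (unitsField (toUField U₀)) (Site.fibreSite 0 (K - n) c.src fun _ => ⟨0, pow_pos (F.P K).L_pos (K - n)⟩)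
              (treeWord fun ν => ((r ν : ℕ) : ℤ))
            * holT (unitsField (toUField U₀)) (Site.fibreSite 0 (K - n) c.src r) (List.replicate (t : ℕ) (c.dir, true)))
          (Z ⟨(fun z : Site (F.P K) 0 => z.shift c.dir)^[(t : ℕ)] (Site.fibreSite 0 (K - n) c.src r), c.dir⟩))
    -- model criticality (Euler–Lagrange in multiplier form): `Lin_{U₀}` vanishes on `ker T_{U₀}`
    (hEL : ∀ Z, T Z = 0 → Λ Z = 0)
    -- a right inverse of `T_{U₀}` with `ℓ¹ → ℓ¹` bound `B·L^{−(K−n)}`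
    (H : (PBond (F.P K) (K - n) → Matrix (Fin 2) (Fin 2) ℂ) → PBond (F.P K) 0 → Matrix (Fin 2) (Fin 2) ℂ) (hTH : ∀ W, T (H W) = W)
    {B : ℝ} (hB : 0 ≤ B) (hH : ∀ W, ∑ b, ‖H W b‖ ≤ B * ((F.L : ℝ) ^ (K - n))⁻¹ * ∑ c, ‖W c‖)
    -- the current bound (print's divergence clause of (6)/(14))
    {j : ℝ} (hj : 0 ≤ j) (hJ : ∀ Z, |Λ Z| ≤ j * (((F.L : ℝ) ^ (K - n)) ^ 3)⁻¹ * ∑ b, ‖Z b‖)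
    (hjB : 4800 * j * B ≤ 1) :
    (1 / 1200) * (((F.L : ℝ) ^ (K - n)) ^ 2)⁻¹ * ∑ b : PBond (F.P K) 0, ‖Y b‖ ^ 2 ≤ wilsonAction4 U - wilsonAction4 U₀ := by
  -- (0) scalars
  have hn0 : (0 : ℝ) < (F.L : ℝ) ^ (K - n) := by
    have : (0 : ℝ) < F.L := by have := F.hL.2; exact_mod_cast (by omega : 0 < F.L)
    positivity
  have hn1 : (1 : ℝ) ≤ (F.L : ℝ) ^ (K - n) := one_le_pow₀ (by have := F.hL.2; exact_mod_cast (by omega : 1 ≤ F.L))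
  have hδ0 : 0 ≤ δ := (norm_nonneg _).trans (hδ ⟨fun _ => 0, ⟨0, (F.P K).hd⟩⟩)
  have hLF : ((F.P K).L : ℝ) = (F.L : ℝ) := by norm_cast
  have hsites := Prop7FlatCoercivity.sitesPerDir_T3 F n K
  -- (1) growth modulo the linear term (p521440)
  have hG := wilsonAction4_sub_background_ge_of_modelFibre_T3 F n K U U₀ Y hYU hε hε1 hU₀ hδ hδn hdiv hfib
  rw [← hΛ Y] at hG
  -- (2) `Λ` and `T` respect differences
  have hΛsub : ∀ Z Z', Λ (Z - Z') = Λ Z - Λ Z' := by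
    intro Z Z'
    rw [hΛ, hΛ, hΛ, ← Finset.sum_sub_distrib]
    refine Finset.sum_congr rfl fun p _ => ?_
    have h := linPlaq_sub_smul U₀ Z Z' 1 p
    simp only [Complex.ofReal_one, one_smul, one_mul] at h
    simp only [Pi.sub_apply]
    exact h.symm
  have hTsub : ∀ Z Z', T (Z - Z') = T Z - T Z' := by
    intro Z Z'
    funext c
    rw [Pi.sub_apply, hT, hT, hT, ← Finset.sum_sub_distrib]
    refine Finset.sum_congr rfl fun r _ => ?_
    rw [← Finset.sum_sub_distrib]
    refine Finset.sum_congr rfl fun t _ => ?_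
    rw [Pi.sub_apply, conjR_sub]
  -- (3) the linearised constraint is second order on the fibre: `Σ_c‖TY(c)‖ ≤ 2L^{2(K−n)}Σ‖Y‖²`
  obtain ⟨hV₀, -⟩ := hyp_of_specialUnitary U₀ hU₀
  have hYrel : ∀ b : PBond (F.P K) 0, ((unitsField (toUField U) b : (Matrix (Fin 2) (Fin 2) ℂ)ˣ) : Matrix (Fin 2) (Fin 2) ℂ)
      = (1 + Y b) * ((unitsField (toUField U₀) b : (Matrix (Fin 2) (Fin 2) ℂ)ˣ) : Matrix (Fin 2) (Fin 2) ℂ) := by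
    intro b
    have hu : star (U₀ b : Matrix (Fin 2) (Fin 2) ℂ) * (U₀ b : Matrix (Fin 2) (Fin 2) ℂ) = 1 :=
      Matrix.mem_unitaryGroup_iff'.mp (Matrix.specialUnitaryGroup_le_unitaryGroup (U₀ b).2)
    show (U b : Matrix (Fin 2) (Fin 2) ℂ) = (1 + Y b) * (U₀ b : Matrix (Fin 2) (Fin 2) ℂ)
    rw [hYU, add_sub_cancel, mul_assoc, hu, mul_one]
  have hnδ : ((F.P K).L : ℝ) ^ (K - n) * δ ≤ 1 := by rw [hLF]; nlinarith only [hδn, hn0, hδ0]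
  have hF : ∑ c : PBond (F.P K) (K - n), ‖T Y c‖ ≤ 2 * ((F.L : ℝ) ^ (K - n)) ^ 2 * ∑ b : PBond (F.P K) 0, ‖Y b‖ ^ 2 := by
    have hc : ∀ c : PBond (F.P K) (K - n), ‖T Y c‖ ≤ ((F.L : ℝ) ^ (K - n)) ^ 2 *
        (∑ r : Fin (F.P K).d → Fin ((F.P K).L ^ (K - n)), ‖Y ⟨Site.fibreSite 0 (K - n) c.src r, c.dir⟩‖ ^ 2
          + ∑ r : Fin (F.P K).d → Fin ((F.P K).L ^ (K - n)), ‖Y ⟨Site.fibreSite 0 (K - n) (runSite c.src c.dir 1) r, c.dir⟩‖ ^ 2) := by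
      intro c
      rw [hT]
      have h1 := norm_covLineSum_le_of_modelFibre (P := F.P K) (k := K - n) hYrel hV₀ hδ hnδ c.dir
        (fun r => holT (unitsField (toUField U₀)) (Site.fibreSite 0 (K - n) c.src fun _ => ⟨0, pow_pos (F.P K).L_pos (K - n)⟩) (treeWord fun ν => ((r ν : ℕ) : ℤ)))
        (fun r => holT_mem hV₀ _ _) (fun r => Site.fibreSite 0 (K - n) c.src r) (hfib c)
      rw [hLF] at h1
      have h2 := sum_sum_normSq_line_le (P := F.P K) (k := K - n) hsites Y c.src c.dir
      rw [hLF] at h2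
      refine h1.trans ?_
      rw [sq, mul_assoc]
      exact mul_le_mul_of_nonneg_left h2 hn0.le
    refine (Finset.sum_le_sum fun c _ => hc c).trans ?_
    rw [← Finset.mul_sum, sum_pair_normSq_eq (P := F.P K) (k := K - n) hsites Y]
    ring_nf
    rfl
  -- (4) the spine
  have hj' : 0 ≤ j * (((F.L : ℝ) ^ (K - n)) ^ 3)⁻¹ := by positivity
  have hB' : 0 ≤ B * ((F.L : ℝ) ^ (K - n))⁻¹ := by positivity
  have hsmall : j * (((F.L : ℝ) ^ (K - n)) ^ 3)⁻¹ * (B * ((F.L : ℝ) ^ (K - n))⁻¹) * (2 * ((F.L : ℝ) ^ (K - n)) ^ 2)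
      ≤ (1 / 600) * (((F.L : ℝ) ^ (K - n)) ^ 2)⁻¹ / 2 := by
    rw [show j * (((F.L : ℝ) ^ (K - n)) ^ 3)⁻¹ * (B * ((F.L : ℝ) ^ (K - n))⁻¹) * (2 * ((F.L : ℝ) ^ (K - n)) ^ 2)
        = (2 * j * B) * (((F.L : ℝ) ^ (K - n)) ^ 2)⁻¹ by field_simp]
    rw [show (1 / 600) * (((F.L : ℝ) ^ (K - n)) ^ 2)⁻¹ / 2 = (1 / 1200) * (((F.L : ℝ) ^ (K - n)) ^ 2)⁻¹ by ring]
    exact mul_le_mul_of_nonneg_right (by linarith) (by positivity)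
  have h := growth_half_of_growthModLin Λ T H hΛsub hTsub hTH hB' hH hEL hj' hJ Y hF hG hsmall
  linarith only [h]

end Model

end Summit.QuantumFields.YangMills.Theorems.Prop7GrowthAssembly

end
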